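import Mathlib
import Literature.Computability.AlgebraicComplexity.PrattTrapezoidVal

/-!
# Pointwise load rules for equilateral trapezoid-free triples

Support file for route `MatrixMultiplication/EisensteinValCertificates`, crux
`stmt-MatrixMultiplication-7788` (`PrimeValSaving`, the `3/2 − δ` rung; equally `PrimeFourThirdsSaving`,
stmt-7790).  Pratt's Def. 3.2 (`Literature.Computability.AlgebraicComplexity.IsEquilateralTrapezoidFree`,
additive notation `a + b + c = 0`) consists of three "at most one solution" systems.  A *point* is a
solution `(a,b,c) ∈ A × B × C` of `a + b + c = 0`; it lies on the `A`-line `a`, the `B`-line `b` and the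
`C`-line `c`.  The `B`-lines through the points of the `A`-line `a` form the set
`{b ∈ B : -(a+b) ∈ C}` (its size is the *load* of the line `a`), and similarly for the other five
incidences.  Everything below holds in every abelian group; nothing is specific to `ℤ/p`.

* `sys₁_eq`, `sys₂_eq`, `sys₃_eq` — the three systems as equalities of whole solution triples;
  `of_subset` — sub-triples of a trapezoid-free triple are trapezoid-free.
* **Prop. 3.6 and the transposition**: `rotate : (A,B,C) ↦ (B,C,A)`, `swap : (A,B,C) ↦ (B,A,C)`,
  `reverse : (A,B,C) ↦ (C,B,A)` preserve trapezoid-freeness — the definition is `S₃`-invariant.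
* **Disjointness rules** (the pointwise content of Def. 3.2): two distinct parallel lines sharing a
  line of a second direction have DISJOINT line sets in the third direction — six instances
  (`disjoint_B_of_A_lines_through_C`, …, `disjoint_A_of_C_lines_through_B`).
* **Local load rules L1–L6**: for every line `ℓ`, the lines of a fixed second direction through the
  points of `ℓ` have total load at most the number of lines of the third direction
  (`load_A_lines_through_C_le`, …, `load_C_lines_through_B_le`).  Summed over `ℓ` these give the three
  Cauchy–Schwarz sums of Prop. 3.1 (see the companion file `…PrimeValSavingDisjointSquares`); they are
  tight for the matrix-multiplication hypergraph and are the calibration a certificate for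
  `PrimeValSaving` must beat POINTWISE — Pratt's Prop. 4.8 / Question 4.9 example satisfies all three
  averaged inequalities with `N^{3/2-o(1)}` solutions, so only the per-line forms carry information
  beyond the exponent `3/2`.

These are the rules L1–L6 / F2 recorded without proof by the survey gate `gate-prattval`
(RESULTS §F2). [cite: Pratt2024, Def. 3.2, Prop. 3.1, Prop. 3.6, Prop. 4.8]
-/

-- single-conjunct summit: the mandated namespace repeats `MatrixMultiplication`.
set_option linter.dupNamespace false

namespace Summit.MatrixMultiplication.MatrixMultiplication.Theorems

namespace PrattValPointwiseLoads

open Finset Literature.Computability.AlgebraicComplexity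

variable {G : Type*} [AddCommGroup G] [DecidableEq G] {A B C : Finset G}

/-! ### The three systems as equalities of solution triples -/

/-- **System 1** (fixed `a' ∈ A`, `b' ∈ B`): two solutions `(aᵢ, bᵢ, cᵢ)` of
`a' + b + c = 0 = a + b' + c` coincide. [cite: Pratt2024, Def. 3.2] -/
theorem sys₁_eq (h : IsEquilateralTrapezoidFree A B C) {a' b' a₁ b₁ c₁ a₂ b₂ c₂ : G}
    (ha' : a' ∈ A) (hb' : b' ∈ B) (ha₁ : a₁ ∈ A) (hb₁ : b₁ ∈ B) (hc₁ : c₁ ∈ C)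
    (ha₂ : a₂ ∈ A) (hb₂ : b₂ ∈ B) (hc₂ : c₂ ∈ C)
    (e₁ : a' + b₁ + c₁ = 0) (f₁ : a₁ + b' + c₁ = 0) (e₂ : a' + b₂ + c₂ = 0)
    (f₂ : a₂ + b' + c₂ = 0) : a₁ = a₂ ∧ b₁ = b₂ ∧ c₁ = c₂ := by
  have key := Finset.card_le_one.1 (h.1 a' ha' b' hb') (a₁, b₁, c₁) ?_ (a₂, b₂, c₂) ?_
  · simpa [Prod.ext_iff] using key
  · simp only [mem_filter, mem_product]
    exact ⟨⟨ha₁, hb₁, hc₁⟩, e₁, f₁⟩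
  · simp only [mem_filter, mem_product]
    exact ⟨⟨ha₂, hb₂, hc₂⟩, e₂, f₂⟩

/-- **System 2** (fixed `a' ∈ A`, `c' ∈ C`): two solutions `(aᵢ, bᵢ, cᵢ)` of
`a' + b + c = 0 = a + b + c'` coincide. [cite: Pratt2024, Def. 3.2] -/
theorem sys₂_eq (h : IsEquilateralTrapezoidFree A B C) {a' c' a₁ b₁ c₁ a₂ b₂ c₂ : G}
    (ha' : a' ∈ A) (hc' : c' ∈ C) (ha₁ : a₁ ∈ A) (hb₁ : b₁ ∈ B) (hc₁ : c₁ ∈ C)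
    (ha₂ : a₂ ∈ A) (hb₂ : b₂ ∈ B) (hc₂ : c₂ ∈ C)
    (e₁ : a' + b₁ + c₁ = 0) (f₁ : a₁ + b₁ + c' = 0) (e₂ : a' + b₂ + c₂ = 0)
    (f₂ : a₂ + b₂ + c' = 0) : a₁ = a₂ ∧ b₁ = b₂ ∧ c₁ = c₂ := by
  have key := Finset.card_le_one.1 (h.2.1 a' ha' c' hc') (a₁, b₁, c₁) ?_ (a₂, b₂, c₂) ?_
  · simpa [Prod.ext_iff] using key
  · simp only [mem_filter, mem_product]
    exact ⟨⟨ha₁, hb₁, hc₁⟩, e₁, f₁⟩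
  · simp only [mem_filter, mem_product]
    exact ⟨⟨ha₂, hb₂, hc₂⟩, e₂, f₂⟩

/-- **System 3** (fixed `b' ∈ B`, `c' ∈ C`): two solutions `(aᵢ, bᵢ, cᵢ)` of
`a + b' + c = 0 = a + b + c'` coincide. [cite: Pratt2024, Def. 3.2] -/
theorem sys₃_eq (h : IsEquilateralTrapezoidFree A B C) {b' c' a₁ b₁ c₁ a₂ b₂ c₂ : G}
    (hb' : b' ∈ B) (hc' : c' ∈ C) (ha₁ : a₁ ∈ A) (hb₁ : b₁ ∈ B) (hc₁ : c₁ ∈ C)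
    (ha₂ : a₂ ∈ A) (hb₂ : b₂ ∈ B) (hc₂ : c₂ ∈ C)
    (e₁ : a₁ + b' + c₁ = 0) (f₁ : a₁ + b₁ + c' = 0) (e₂ : a₂ + b' + c₂ = 0)
    (f₂ : a₂ + b₂ + c' = 0) : a₁ = a₂ ∧ b₁ = b₂ ∧ c₁ = c₂ := by
  have key := Finset.card_le_one.1 (h.2.2 b' hb' c' hc') (a₁, b₁, c₁) ?_ (a₂, b₂, c₂) ?_
  · simpa [Prod.ext_iff] using key
  · simp only [mem_filter, mem_product]
    exact ⟨⟨ha₁, hb₁, hc₁⟩, e₁, f₁⟩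
  · simp only [mem_filter, mem_product]
    exact ⟨⟨ha₂, hb₂, hc₂⟩, e₂, f₂⟩

/-! ### Sub-triples -/

/-- Sub-triples of an equilateral trapezoid-free triple are equilateral trapezoid-free (each system
only loses solutions). [cite: Pratt2024, Def. 3.2] -/
theorem of_subset (h : IsEquilateralTrapezoidFree A B C) {A' B' C' : Finset G} (hA : A' ⊆ A)
    (hB : B' ⊆ B) (hC : C' ⊆ C) : IsEquilateralTrapezoidFree A' B' C' := by
  have hprod : A' ×ˢ B' ×ˢ C' ⊆ A ×ˢ B ×ˢ C :=
    product_subset_product hA (product_subset_product hB hC)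
  refine ⟨fun a' ha' b' hb' => ?_, fun a' ha' c' hc' => ?_, fun b' hb' c' hc' => ?_⟩
  · exact (card_le_card (filter_subset_filter _ hprod)).trans (h.1 a' (hA ha') b' (hB hb'))
  · exact (card_le_card (filter_subset_filter _ hprod)).trans (h.2.1 a' (hA ha') c' (hC hc'))
  · exact (card_le_card (filter_subset_filter _ hprod)).trans (h.2.2 b' (hB hb') c' (hC hc'))

/-! ### `S₃`-symmetry (Prop. 3.6 and the transposition) -/

/-- **Pratt 2024, Prop. 3.6**: trapezoid-freeness is preserved by the cyclic permutation
`(A, B, C) ↦ (B, C, A)` (abelian groups). [cite: Pratt2024, Prop. 3.6] -/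
theorem rotate (h : IsEquilateralTrapezoidFree A B C) : IsEquilateralTrapezoidFree B C A := by
  refine ⟨fun b' hb' c' hc' => ?_, fun b' hb' a' ha' => ?_, fun c' hc' a' ha' => ?_⟩
  · refine Finset.card_le_one.2 fun t ht t' ht' => ?_
    simp only [mem_filter, mem_product] at ht ht'
    obtain ⟨⟨hb, hc, ha⟩, e, f⟩ := ht
    obtain ⟨⟨hb₂, hc₂, ha₂⟩, e₂, f₂⟩ := ht'
    obtain ⟨h1, h2, h3⟩ := sys₃_eq h hb' hc' ha hb hc ha₂ hb₂ hc₂ (by rw [← e]; abel)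
      (by rw [← f]; abel) (by rw [← e₂]; abel) (by rw [← f₂]; abel)
    exact Prod.ext h2 (Prod.ext h3 h1)
  · refine Finset.card_le_one.2 fun t ht t' ht' => ?_
    simp only [mem_filter, mem_product] at ht ht'
    obtain ⟨⟨hb, hc, ha⟩, e, f⟩ := ht
    obtain ⟨⟨hb₂, hc₂, ha₂⟩, e₂, f₂⟩ := ht'
    obtain ⟨h1, h2, h3⟩ := sys₁_eq h ha' hb' ha hb hc ha₂ hb₂ hc₂ (by rw [← f]; abel)
      (by rw [← e]; abel) (by rw [← f₂]; abel) (by rw [← e₂]; abel)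
    exact Prod.ext h2 (Prod.ext h3 h1)
  · refine Finset.card_le_one.2 fun t ht t' ht' => ?_
    simp only [mem_filter, mem_product] at ht ht'
    obtain ⟨⟨hb, hc, ha⟩, e, f⟩ := ht
    obtain ⟨⟨hb₂, hc₂, ha₂⟩, e₂, f₂⟩ := ht'
    obtain ⟨h1, h2, h3⟩ := sys₂_eq h ha' hc' ha hb hc ha₂ hb₂ hc₂ (by rw [← f]; abel)
      (by rw [← e]; abel) (by rw [← f₂]; abel) (by rw [← e₂]; abel)
    exact Prod.ext h2 (Prod.ext h3 h1)

/-- Trapezoid-freeness is preserved by the transposition `(A, B, C) ↦ (B, A, C)` (abelian groups);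
with `rotate` the definition is invariant under all six permutations. [cite: Pratt2024, Def. 3.2] -/
theorem swap (h : IsEquilateralTrapezoidFree A B C) : IsEquilateralTrapezoidFree B A C := by
  refine ⟨fun b' hb' a' ha' => ?_, fun b' hb' c' hc' => ?_, fun a' ha' c' hc' => ?_⟩
  · refine Finset.card_le_one.2 fun t ht t' ht' => ?_
    simp only [mem_filter, mem_product] at ht ht'
    obtain ⟨⟨hb, ha, hc⟩, e, f⟩ := ht
    obtain ⟨⟨hb₂, ha₂, hc₂⟩, e₂, f₂⟩ := ht'
    obtain ⟨h1, h2, h3⟩ := sys₁_eq h ha' hb' ha hb hc ha₂ hb₂ hc₂ (by rw [← f]; abel)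
      (by rw [← e]; abel) (by rw [← f₂]; abel) (by rw [← e₂]; abel)
    exact Prod.ext h2 (Prod.ext h1 h3)
  · refine Finset.card_le_one.2 fun t ht t' ht' => ?_
    simp only [mem_filter, mem_product] at ht ht'
    obtain ⟨⟨hb, ha, hc⟩, e, f⟩ := ht
    obtain ⟨⟨hb₂, ha₂, hc₂⟩, e₂, f₂⟩ := ht'
    obtain ⟨h1, h2, h3⟩ := sys₃_eq h hb' hc' ha hb hc ha₂ hb₂ hc₂ (by rw [← e]; abel)
      (by rw [← f]; abel) (by rw [← e₂]; abel) (by rw [← f₂]; abel)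
    exact Prod.ext h2 (Prod.ext h1 h3)
  · refine Finset.card_le_one.2 fun t ht t' ht' => ?_
    simp only [mem_filter, mem_product] at ht ht'
    obtain ⟨⟨hb, ha, hc⟩, e, f⟩ := ht
    obtain ⟨⟨hb₂, ha₂, hc₂⟩, e₂, f₂⟩ := ht'
    obtain ⟨h1, h2, h3⟩ := sys₂_eq h ha' hc' ha hb hc ha₂ hb₂ hc₂ (by rw [← e]; abel)
      (by rw [← f]; abel) (by rw [← e₂]; abel) (by rw [← f₂]; abel)
    exact Prod.ext h2 (Prod.ext h1 h3)

/-- The reflection `(A, B, C) ↦ (C, B, A)`. [cite: Pratt2024, Def. 3.2 and Prop. 3.6] -/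
theorem reverse (h : IsEquilateralTrapezoidFree A B C) : IsEquilateralTrapezoidFree C B A :=
  swap (rotate h)

/-! ### Disjointness rules: linked parallel lines have disjoint third-direction line sets -/

/-- Two distinct `A`-lines through a common `C`-line `c` have disjoint `B`-line sets
(system 3). [cite: Pratt2024, Def. 3.2] -/
theorem disjoint_B_of_A_lines_through_C (h : IsEquilateralTrapezoidFree A B C) {c a₁ a₂ : G}
    (hc : c ∈ C) (ha₁ : a₁ ∈ A) (ha₂ : a₂ ∈ A) (h₁ : -(a₁ + c) ∈ B) (h₂ : -(a₂ + c) ∈ B)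
    (hne : a₁ ≠ a₂) :
    Disjoint (B.filter fun b => -(a₁ + b) ∈ C) (B.filter fun b => -(a₂ + b) ∈ C) := by
  refine Finset.disjoint_left.2 fun b hb₁ hb₂ => hne ?_
  simp only [mem_filter] at hb₁ hb₂
  exact (sys₃_eq h hb₁.1 hc ha₁ h₁ hb₁.2 ha₂ h₂ hb₂.2 (add_neg_cancel _) (by abel)
    (add_neg_cancel _) (by abel)).1

/-- Two distinct `A`-lines through a common `B`-line `b` have disjoint `C`-line sets
(system 3). [cite: Pratt2024, Def. 3.2] -/
theorem disjoint_C_of_A_lines_through_B (h : IsEquilateralTrapezoidFree A B C) {b a₁ a₂ : G}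
    (hb : b ∈ B) (ha₁ : a₁ ∈ A) (ha₂ : a₂ ∈ A) (h₁ : -(a₁ + b) ∈ C) (h₂ : -(a₂ + b) ∈ C)
    (hne : a₁ ≠ a₂) :
    Disjoint (C.filter fun c => -(a₁ + c) ∈ B) (C.filter fun c => -(a₂ + c) ∈ B) := by
  refine Finset.disjoint_left.2 fun c hc₁ hc₂ => hne ?_
  simp only [mem_filter] at hc₁ hc₂
  exact (sys₃_eq h hb hc₁.1 ha₁ hc₁.2 h₁ ha₂ hc₂.2 h₂ (add_neg_cancel _) (by abel)
    (add_neg_cancel _) (by abel)).1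

/-- Two distinct `B`-lines through a common `A`-line `a` have disjoint `C`-line sets
(system 2). [cite: Pratt2024, Def. 3.2] -/
theorem disjoint_C_of_B_lines_through_A (h : IsEquilateralTrapezoidFree A B C) {a b₁ b₂ : G}
    (ha : a ∈ A) (hb₁ : b₁ ∈ B) (hb₂ : b₂ ∈ B) (h₁ : -(a + b₁) ∈ C) (h₂ : -(a + b₂) ∈ C)
    (hne : b₁ ≠ b₂) :
    Disjoint (C.filter fun c => -(b₁ + c) ∈ A) (C.filter fun c => -(b₂ + c) ∈ A) := by
  refine Finset.disjoint_left.2 fun c hc₁ hc₂ => hne ?_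
  simp only [mem_filter] at hc₁ hc₂
  exact (sys₂_eq h ha hc₁.1 hc₁.2 hb₁ h₁ hc₂.2 hb₂ h₂ (add_neg_cancel _) (by abel)
    (add_neg_cancel _) (by abel)).2.1

/-- Two distinct `B`-lines through a common `C`-line `c` have disjoint `A`-line sets
(system 2). [cite: Pratt2024, Def. 3.2] -/
theorem disjoint_A_of_B_lines_through_C (h : IsEquilateralTrapezoidFree A B C) {c b₁ b₂ : G}
    (hc : c ∈ C) (hb₁ : b₁ ∈ B) (hb₂ : b₂ ∈ B) (h₁ : -(b₁ + c) ∈ A) (h₂ : -(b₂ + c) ∈ A)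
    (hne : b₁ ≠ b₂) :
    Disjoint (A.filter fun a => -(a + b₁) ∈ C) (A.filter fun a => -(a + b₂) ∈ C) := by
  refine Finset.disjoint_left.2 fun a ha₁ ha₂ => hne ?_
  simp only [mem_filter] at ha₁ ha₂
  exact (sys₂_eq h ha₁.1 hc h₁ hb₁ ha₁.2 h₂ hb₂ ha₂.2 (by abel) (by abel)
    (by abel) (by abel)).2.1

/-- Two distinct `C`-lines through a common `A`-line `a` have disjoint `B`-line sets
(system 1). [cite: Pratt2024, Def. 3.2] -/
theorem disjoint_B_of_C_lines_through_A (h : IsEquilateralTrapezoidFree A B C) {a c₁ c₂ : G}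
    (ha : a ∈ A) (hc₁ : c₁ ∈ C) (hc₂ : c₂ ∈ C) (h₁ : -(a + c₁) ∈ B) (h₂ : -(a + c₂) ∈ B)
    (hne : c₁ ≠ c₂) :
    Disjoint (B.filter fun b => -(b + c₁) ∈ A) (B.filter fun b => -(b + c₂) ∈ A) := by
  refine Finset.disjoint_left.2 fun b hb₁ hb₂ => hne ?_
  simp only [mem_filter] at hb₁ hb₂
  exact (sys₁_eq h ha hb₁.1 hb₁.2 h₁ hc₁ hb₂.2 h₂ hc₂ (by abel) (by abel)
    (by abel) (by abel)).2.2

/-- Two distinct `C`-lines through a common `B`-line `b` have disjoint `A`-line sets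
(system 1). [cite: Pratt2024, Def. 3.2] -/
theorem disjoint_A_of_C_lines_through_B (h : IsEquilateralTrapezoidFree A B C) {b c₁ c₂ : G}
    (hb : b ∈ B) (hc₁ : c₁ ∈ C) (hc₂ : c₂ ∈ C) (h₁ : -(b + c₁) ∈ A) (h₂ : -(b + c₂) ∈ A)
    (hne : c₁ ≠ c₂) :
    Disjoint (A.filter fun a => -(a + c₁) ∈ B) (A.filter fun a => -(a + c₂) ∈ B) := by
  refine Finset.disjoint_left.2 fun a ha₁ ha₂ => hne ?_
  simp only [mem_filter] at ha₁ ha₂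
  exact (sys₁_eq h ha₁.1 hb h₁ ha₁.2 hc₁ h₂ ha₂.2 hc₂ (by abel) (by abel)
    (by abel) (by abel)).2.2

/-! ### Local loads (six instances) -/

/-- **Load rule L1.** The `B`-line sets of the `A`-lines through a fixed `C`-line `c` are pairwise
disjoint, so their sizes (the loads of those `A`-lines) add up to at most `#B`.
[cite: Pratt2024, Def. 3.2 (system 3)] -/
theorem load_A_lines_through_C_le (h : IsEquilateralTrapezoidFree A B C) {c : G} (hc : c ∈ C) :
    ∑ a ∈ A.filter (fun a => -(a + c) ∈ B), #(B.filter fun b => -(a + b) ∈ C) ≤ #B := by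
  rw [← card_biUnion]
  · exact card_le_card (biUnion_subset.2 fun a _ => filter_subset _ _)
  · intro a₁ ha₁ a₂ ha₂ hne
    have ha₁' := mem_filter.1 (mem_coe.1 ha₁)
    have ha₂' := mem_filter.1 (mem_coe.1 ha₂)
    exact disjoint_B_of_A_lines_through_C h hc ha₁'.1 ha₂'.1 ha₁'.2 ha₂'.2 hne

/-- **Load rule L2.** The `C`-line sets of the `A`-lines through a fixed `B`-line `b` are pairwise
disjoint; their sizes add up to at most `#C`. [cite: Pratt2024, Def. 3.2 (system 3)] -/
theorem load_A_lines_through_B_le (h : IsEquilateralTrapezoidFree A B C) {b : G} (hb : b ∈ B) :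
    ∑ a ∈ A.filter (fun a => -(a + b) ∈ C), #(C.filter fun c => -(a + c) ∈ B) ≤ #C := by
  rw [← card_biUnion]
  · exact card_le_card (biUnion_subset.2 fun a _ => filter_subset _ _)
  · intro a₁ ha₁ a₂ ha₂ hne
    have ha₁' := mem_filter.1 (mem_coe.1 ha₁)
    have ha₂' := mem_filter.1 (mem_coe.1 ha₂)
    exact disjoint_C_of_A_lines_through_B h hb ha₁'.1 ha₂'.1 ha₁'.2 ha₂'.2 hne

/-- **Load rule L3.** The `C`-line sets of the `B`-lines through a fixed `A`-line `a` are pairwise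
disjoint; their sizes add up to at most `#C`. [cite: Pratt2024, Def. 3.2 (system 2)] -/
theorem load_B_lines_through_A_le (h : IsEquilateralTrapezoidFree A B C) {a : G} (ha : a ∈ A) :
    ∑ b ∈ B.filter (fun b => -(a + b) ∈ C), #(C.filter fun c => -(b + c) ∈ A) ≤ #C := by
  rw [← card_biUnion]
  · exact card_le_card (biUnion_subset.2 fun b _ => filter_subset _ _)
  · intro b₁ hb₁ b₂ hb₂ hne
    have hb₁' := mem_filter.1 (mem_coe.1 hb₁)
    have hb₂' := mem_filter.1 (mem_coe.1 hb₂)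
    exact disjoint_C_of_B_lines_through_A h ha hb₁'.1 hb₂'.1 hb₁'.2 hb₂'.2 hne

/-- **Load rule L4.** The `A`-line sets of the `B`-lines through a fixed `C`-line `c` are pairwise
disjoint; their sizes add up to at most `#A`. [cite: Pratt2024, Def. 3.2 (system 2)] -/
theorem load_B_lines_through_C_le (h : IsEquilateralTrapezoidFree A B C) {c : G} (hc : c ∈ C) :
    ∑ b ∈ B.filter (fun b => -(b + c) ∈ A), #(A.filter fun a => -(a + b) ∈ C) ≤ #A := by
  rw [← card_biUnion]
  · exact card_le_card (biUnion_subset.2 fun b _ => filter_subset _ _)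
  · intro b₁ hb₁ b₂ hb₂ hne
    have hb₁' := mem_filter.1 (mem_coe.1 hb₁)
    have hb₂' := mem_filter.1 (mem_coe.1 hb₂)
    exact disjoint_A_of_B_lines_through_C h hc hb₁'.1 hb₂'.1 hb₁'.2 hb₂'.2 hne

/-- **Load rule L5.** The `B`-line sets of the `C`-lines through a fixed `A`-line `a` are pairwise
disjoint; their sizes add up to at most `#B`. [cite: Pratt2024, Def. 3.2 (system 1)] -/
theorem load_C_lines_through_A_le (h : IsEquilateralTrapezoidFree A B C) {a : G} (ha : a ∈ A) :
    ∑ c ∈ C.filter (fun c => -(a + c) ∈ B), #(B.filter fun b => -(b + c) ∈ A) ≤ #B := by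
  rw [← card_biUnion]
  · exact card_le_card (biUnion_subset.2 fun c _ => filter_subset _ _)
  · intro c₁ hc₁ c₂ hc₂ hne
    have hc₁' := mem_filter.1 (mem_coe.1 hc₁)
    have hc₂' := mem_filter.1 (mem_coe.1 hc₂)
    exact disjoint_B_of_C_lines_through_A h ha hc₁'.1 hc₂'.1 hc₁'.2 hc₂'.2 hne

/-- **Load rule L6.** The `A`-line sets of the `C`-lines through a fixed `B`-line `b` are pairwise
disjoint; their sizes add up to at most `#A`. [cite: Pratt2024, Def. 3.2 (system 1)] -/
theorem load_C_lines_through_B_le (h : IsEquilateralTrapezoidFree A B C) {b : G} (hb : b ∈ B) :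
    ∑ c ∈ C.filter (fun c => -(b + c) ∈ A), #(A.filter fun a => -(a + c) ∈ B) ≤ #A := by
  rw [← card_biUnion]
  · exact card_le_card (biUnion_subset.2 fun c _ => filter_subset _ _)
  · intro c₁ hc₁ c₂ hc₂ hne
    have hc₁' := mem_filter.1 (mem_coe.1 hc₁)
    have hc₂' := mem_filter.1 (mem_coe.1 hc₂)
    exact disjoint_A_of_C_lines_through_B h hb hc₁'.1 hc₂'.1 hc₁'.2 hc₂'.2 hne

end PrattValPointwiseLoads

end Summit.MatrixMultiplication.MatrixMultiplication.Theorems
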